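import Mathlib
import Summits.Ventures.PercRepro2.UniversalClosures

/-! # (UH*) for `X` in series with a bundle of two free edges — from the graded family of `X` alone
(seat mine-b, cell pub-perc-repro2; MINE-B.md §22)

`X ∧ B₂` = a labelled poset `X` in series with two parallel free edges: states `(x, e)` with `e : Bool × Bool`
(`true` = blue), labels `r = min (r x) (2 − β e)`, `b = min (b x) (β e)` where `β e` = the number of blue edges.
The universal level-conditioned Hall statement `Universal` (MINE-B.md §18.1(a), UniversalClosures.lean) holds on
`X ∧ B₂` as soon as `X` carries `G_1` (`DownDom`), the level-1 Harris inequality and `V2_2` — NO universal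
statement on `X` is needed (unlike the general series step, and unlike bundles of ≥ 3 edges, where the family alone is
not enough on general posets).  The assignment, by the three private assignments of the hypotheses:

* `(x, 11)` with `r x ≥ 1` (demand `min (b x) 2`): its own column, `(x, 10)` then `(x, 01)`;
* `(x, 11)` with `r x = 0`, `b x ≥ 2`: `(v₂ (x, i), 01)` — the `V2_2`-targets (`b = 1`, `r ≥ 1`), in the state `01`;
* `(x, 11)` with `r x = 0`, `b x = 1`: `(g₁ (x, 0), 00)` — a `G_1`-target (`r = 1`), in the state `00`;
* `(x, 10)`, `(x, 01)` with `r x = 0` (demand `1`): `(h x, e)` — the level-1 Harris target (`r ≥ 1`, `b = 0`) in the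
  same state.

The images are separated by the state and by the blue label of the `X`-coordinate (`≥ 2` / `= 1` / `= 0` in the state
`01`; `≥ 1` / `= 0` in the state `10`), so the assignment is injective. -/

namespace Summit.Ventures.PercRepro2.UHClosure

open Finset

variable {X : Type*} [Preorder X] [Fintype X] [DecidableEq X] [DecidableRel (α := X) (· ≤ ·)]

/-- the number of blue edges of a state of the two-edge bundle -/
def bl (e : Bool × Bool) : ℕ := (if e.1 then 1 else 0) + (if e.2 then 1 else 0)

/-- the red label of `X` in series with a bundle of two free edges -/
abbrev serR2 (r : X → ℕ) : X × (Bool × Bool) → ℕ := fun p => min (r p.1) (2 - bl p.2)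
/-- the blue label of `X` in series with a bundle of two free edges -/
abbrev serB2 (b : X → ℕ) : X × (Bool × Bool) → ℕ := fun p => min (b p.1) (bl p.2)

section harris

variable (r b : X → ℕ)

omit [Fintype X] [DecidableEq X] [DecidableRel (α := X) (· ≤ ·)] in
/-- the CROSS form of the level-1 Harris inequality as a lower-set domination: every source `r = 0, b ≥ 1` owns a
private `r ≥ 1, b = 0` below it (the same inequality, disjoint footprints) -/
theorem lowerDom_cross_of_levelHarris1 (h : LevelHarris r b) :
    LowerDom (fun x => r x = 0 ∧ 1 ≤ b x) (fun x => 1 ≤ r x ∧ b x = 0) (fun _ => 1) := by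
  intro D hD
  have := h D hD 1
  have e : ∑ x ∈ D, ((if 1 ≤ r x ∧ b x = 0 then (1 : ℤ) else 0) - (if r x = 0 ∧ 1 ≤ b x then ((1 : ℕ) : ℤ) else 0))
      = ∑ x ∈ D, ((if 1 ≤ r x then (1 : ℤ) else 0) - (if 1 ≤ b x then (1 : ℤ) else 0)) := by
    apply Finset.sum_congr rfl
    intro x _
    by_cases h1 : 1 ≤ r x <;> by_cases h2 : 1 ≤ b x <;> simp [h1, h2] <;> omega
  rw [e, Finset.sum_sub_distrib]
  have e1 : ∑ x ∈ D, (if 1 ≤ r x then (1 : ℤ) else 0) = ((D.filter (fun x => 1 ≤ r x)).card : ℤ) := by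
    rw [Finset.card_filter]; push_cast; rfl
  have e2 : ∑ x ∈ D, (if 1 ≤ b x then (1 : ℤ) else 0) = ((D.filter (fun x => 1 ≤ b x)).card : ℤ) := by
    rw [Finset.card_filter]; push_cast; rfl
  rw [e1, e2]
  have : ((D.filter (fun x => 1 ≤ b x)).card : ℤ) ≤ ((D.filter (fun x => 1 ≤ r x)).card : ℤ) := by exact_mod_cast this
  linarith

end harris

section bundle

variable (r b : X → ℕ)

omit [Preorder X] [Fintype X] [DecidableEq X] [DecidableRel (α := X) (· ≤ ·)] in
/-- a source of the bundle product: the all-blue state with `b x ≥ 1`, or a one-blue state with `r x = 0`, `b x ≥ 1` -/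
lemma src_bundle {p : X × (Bool × Bool)} (h : USrc (serR2 r) (serB2 b) p) :
    (p.2 = (true, true) ∧ 1 ≤ b p.1) ∨ ((p.2 = (true, false) ∨ p.2 = (false, true)) ∧ r p.1 = 0 ∧ 1 ≤ b p.1) := by
  obtain ⟨h1, h2⟩ := h
  rcases p with ⟨x, ⟨e1, e2⟩⟩
  cases e1 <;> cases e2 <;> simp [bl, serR2, serB2] at h1 h2 ⊢ <;> omega

omit [Preorder X] [Fintype X] [DecidableEq X] [DecidableRel (α := X) (· ≤ ·)] in
/-- the all-blue state has two blue edges -/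
lemma bl_tt : bl (true, true) = 2 := rfl
omit [Preorder X] [Fintype X] [DecidableEq X] [DecidableRel (α := X) (· ≤ ·)] in
/-- the state `10` has one blue edge -/
lemma bl_tf : bl (true, false) = 1 := rfl
omit [Preorder X] [Fintype X] [DecidableEq X] [DecidableRel (α := X) (· ≤ ·)] in
/-- the state `01` has one blue edge -/
lemma bl_ft : bl (false, true) = 1 := rfl
omit [Preorder X] [Fintype X] [DecidableEq X] [DecidableRel (α := X) (· ≤ ·)] in
/-- the all-red state has no blue edge -/
lemma bl_ff : bl (false, false) = 0 := rfl

/-- the three private assignments of the hypotheses, packaged -/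
structure Assign (r b : X → ℕ) where
  /-- the `G_1` assignment: `r = 1` targets -/
  g : SlotL (fun x => r x = 0 ∧ 1 ≤ b x) b → X
  hg : Function.Injective g
  hgs : ∀ p, g p ≤ p.1.1.1 ∧ r (g p) = 1
  /-- the `V2_2` assignment: `b = 1`, `r ≥ 1` targets -/
  v : SlotL (fun x => r x = 0 ∧ 2 ≤ b x) b → X
  hv : Function.Injective v
  hvs : ∀ p, v p ≤ p.1.1.1 ∧ b (v p) = 1 ∧ 1 ≤ r (v p)
  /-- the level-1 Harris assignment: `r ≥ 1`, `b = 0` targets -/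
  h : SlotL (fun x => r x = 0 ∧ 1 ≤ b x) (fun _ => 1) → X
  hh : Function.Injective h
  hhs : ∀ p, h p ≤ p.1.1.1 ∧ 1 ≤ r (h p) ∧ b (h p) = 0

/-- the hypotheses give the three assignments -/
theorem assign_exists (hG : GDom 1 r b) (hV : VDom 2 r b) (hH : LevelHarris r b) : Nonempty (Assign r b) := by
  obtain ⟨g, hg, hgs⟩ := exists_private_targets_of_gDom 1 r b hG
  obtain ⟨v, hv, hvs⟩ := exists_private_targets_of_vDom 2 r b hV
  obtain ⟨h, hh, hhs⟩ := exists_private_targets_of_lowerDom _ _ (fun _ => 1) (lowerDom_cross_of_levelHarris1 r b hH)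
  exact ⟨⟨g, hg, fun p => ⟨(hgs p).1, (hgs p).2.1⟩, v, hv, fun p => ⟨(hvs p).1, by have := (hvs p).2.1; simpa using this, (hvs p).2.2⟩,
    h, hh, hhs⟩⟩

variable {r b}

/-- the slot type of the bundle product -/
abbrev BSlot := SlotL (USrc (serR2 r) (serB2 b)) (serB2 b)

omit [Preorder X] [DecidableEq X] [DecidableRel (α := X) (· ≤ ·)] in
/-- the index of a slot in the all-blue state is `< min (b x) 2` -/
lemma idx_lt_tt (q : BSlot (r := r) (b := b)) (he : q.1.1.1.2 = (true, true)) : q.1.2.val < min (b q.1.1.1.1) 2 := by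
  have := q.2; simp only [serB2] at this; rw [he] at this; simpa [bl] using this

omit [Preorder X] [DecidableEq X] [DecidableRel (α := X) (· ≤ ·)] in
/-- a one-blue-state source has `r x = 0`, `b x ≥ 1` and index `0` -/
lemma one_blue (q : BSlot (r := r) (b := b)) (he : q.1.1.1.2 = (true, false) ∨ q.1.1.1.2 = (false, true)) :
    r q.1.1.1.1 = 0 ∧ 1 ≤ b q.1.1.1.1 ∧ q.1.2.val = 0 := by
  have hs := q.1.1.2.1
  have hi := q.2
  obtain ⟨h1, h2⟩ := hs
  rcases he with he | he <;> simp only [serR2, serB2] at h1 h2 hi <;> rw [he] at h1 h2 hi <;> simp [bl] at h1 h2 hi <;>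
    exact ⟨h1, h2, by omega⟩

omit [Preorder X] [DecidableEq X] [DecidableRel (α := X) (· ≤ ·)] in
/-- the state of a source is not all-red -/
lemma not_ff (q : BSlot (r := r) (b := b)) : q.1.1.1.2 ≠ (false, false) := by
  intro he
  have := q.1.1.2.2
  simp only [serB2] at this; rw [he] at this; simp [bl] at this

/-- the `G_1`-slot `(x, 0)` of a source `x` with `r x = 0`, `b x ≥ 1` -/
def gslot (x : X) (hx : r x = 0 ∧ 1 ≤ b x) : SlotL (fun x => r x = 0 ∧ 1 ≤ b x) b :=
  ⟨⟨⟨x, hx, hx.2⟩, ⟨0, by have := lt_boundL b x; omega⟩⟩, hx.2⟩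

/-- the `V2_2`-slot `(x, i)` of a source `x` with `b x ≥ 2`, `i < b x` -/
def vslot (x : X) (hx : r x = 0 ∧ 2 ≤ b x) (i : ℕ) (hi : i < b x) : SlotL (fun x => r x = 0 ∧ 2 ≤ b x) b :=
  ⟨⟨⟨x, hx, by omega⟩, ⟨i, lt_of_lt_of_le hi (le_of_lt (lt_boundL b x))⟩⟩, hi⟩

/-- the Harris slot of a source `x` with `r x = 0`, `b x ≥ 1` -/
def hslot (x : X) (hx : r x = 0 ∧ 1 ≤ b x) : SlotL (fun x => r x = 0 ∧ 1 ≤ b x) (fun _ => 1) :=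
  ⟨⟨⟨x, hx, le_rfl⟩, ⟨0, by have := lt_boundL (fun _ : X => 1) x; omega⟩⟩, Nat.one_pos⟩

omit [Preorder X] [DecidableEq X] [DecidableRel (α := X) (· ≤ ·)] in
/-- a source in the all-blue state has `b x ≥ 1` -/
lemma tt_b (q : BSlot (r := r) (b := b)) (he : q.1.1.1.2 = (true, true)) : 1 ≤ b q.1.1.1.1 := by
  have := idx_lt_tt q he; omega

omit [Preorder X] [DecidableEq X] [DecidableRel (α := X) (· ≤ ·)] in
/-- a source not in the all-blue state is in a one-blue state -/
lemma one_blue_of_ne (q : BSlot (r := r) (b := b)) (he : ¬ q.1.1.1.2 = (true, true)) :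
    q.1.1.1.2 = (true, false) ∨ q.1.1.1.2 = (false, true) := by
  have := not_ff q
  rcases hq : q.1.1.1.2 with ⟨e1, e2⟩
  rw [hq] at he this
  cases e1 <;> cases e2 <;> simp_all

/-- **the assignment** on the bundle product -/
noncomputable def bundleAssign (A : Assign r b) (q : BSlot (r := r) (b := b)) : X × (Bool × Bool) :=
  if he : q.1.1.1.2 = (true, true) then
    if hr : 1 ≤ r q.1.1.1.1 then (if q.1.2.val = 0 then (q.1.1.1.1, (true, false)) else (q.1.1.1.1, (false, true)))
    else if hb : 2 ≤ b q.1.1.1.1 then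
      (A.v (vslot q.1.1.1.1 ⟨by omega, hb⟩ q.1.2.val (lt_of_lt_of_le (idx_lt_tt q he) (min_le_left _ _))), (false, true))
    else (A.g (gslot q.1.1.1.1 ⟨by omega, tt_b q he⟩), (false, false))
  else (A.h (hslot q.1.1.1.1 ⟨(one_blue q (one_blue_of_ne q he)).1, (one_blue q (one_blue_of_ne q he)).2.1⟩), q.1.1.1.2)

omit [DecidableEq X] [DecidableRel (α := X) (· ≤ ·)] in
/-- the targets of the assignment: below the source, red level `1`, blue level `≥` the source's level `− 1` -/
theorem bundleAssign_spec (A : Assign r b) (q : BSlot (r := r) (b := b)) :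
    bundleAssign A q ≤ q.1.1.1 ∧ serR2 r (bundleAssign A q) = 1 ∧
      serB2 b q.1.1.1 ≤ serB2 b (bundleAssign A q) + 1 := by
  unfold bundleAssign
  by_cases he : q.1.1.1.2 = (true, true)
  · rw [dif_pos he]
    have hb1 := tt_b q he
    have hi := idx_lt_tt q he
    by_cases hr : 1 ≤ r q.1.1.1.1
    · rw [dif_pos hr]
      by_cases hi0 : q.1.2.val = 0
      · rw [if_pos hi0]
        refine ⟨Prod.mk_le_mk.2 ⟨le_rfl, by rw [he]; exact Prod.mk_le_mk.2 ⟨le_rfl, Bool.false_le _⟩⟩, ?_, ?_⟩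
        · simp only [serR2, bl_tf]; omega
        · simp only [serB2, bl_tf]; rw [he]; simp only [bl_tt]; omega
      · rw [if_neg hi0]
        refine ⟨Prod.mk_le_mk.2 ⟨le_rfl, by rw [he]; exact Prod.mk_le_mk.2 ⟨Bool.false_le _, le_rfl⟩⟩, ?_, ?_⟩
        · simp only [serR2, bl_ft]; omega
        · simp only [serB2, bl_ft]; rw [he]; simp only [bl_tt]; omega
    · rw [dif_neg hr]
      by_cases hb : 2 ≤ b q.1.1.1.1
      · rw [dif_pos hb]
        obtain ⟨hle, hbv, hrv⟩ := A.hvs (vslot q.1.1.1.1 ⟨by omega, hb⟩ q.1.2.val (lt_of_lt_of_le hi (min_le_left _ _)))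
        refine ⟨Prod.mk_le_mk.2 ⟨hle, by rw [he]; exact Prod.mk_le_mk.2 ⟨Bool.false_le _, le_rfl⟩⟩, ?_, ?_⟩
        · simp only [serR2, bl_ft]; omega
        · simp only [serB2, bl_ft]; rw [he]; simp only [bl_tt]; omega
      · rw [dif_neg hb]
        obtain ⟨hle, hrg⟩ := A.hgs (gslot q.1.1.1.1 ⟨by omega, hb1⟩)
        refine ⟨Prod.mk_le_mk.2 ⟨hle, by rw [he]; exact Prod.mk_le_mk.2 ⟨Bool.false_le _, Bool.false_le _⟩⟩, ?_, ?_⟩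
        · simp only [serR2, bl_ff]; omega
        · simp only [serB2, bl_ff]; rw [he]; simp only [bl_tt]; omega
  · rw [dif_neg he]
    have h1 := one_blue q (one_blue_of_ne q he)
    obtain ⟨hle, hrh, hbh⟩ := A.hhs (hslot q.1.1.1.1 ⟨h1.1, h1.2.1⟩)
    refine ⟨Prod.mk_le_mk.2 ⟨hle, le_rfl⟩, ?_, ?_⟩
    · rcases one_blue_of_ne q he with h | h <;> simp only [serR2] <;> rw [h] <;> simp only [bl_tf, bl_ft] <;> omega
    · rcases one_blue_of_ne q he with h | h <;> simp only [serB2] <;> rw [h] <;> simp only [bl_tf, bl_ft] <;> omega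

omit [Preorder X] [DecidableEq X] [DecidableRel (α := X) (· ≤ ·)] in
/-- two slots with the same source and the same index are equal -/
lemma bslot_ext (q q' : BSlot (r := r) (b := b)) (h1 : q.1.1.1 = q'.1.1.1) (h2 : q.1.2.val = q'.1.2.val) : q = q' := by
  apply Subtype.ext; apply Prod.ext
  · exact Subtype.ext h1
  · exact Fin.ext h2

omit [Preorder X] [DecidableEq X] [DecidableRel (α := X) (· ≤ ·)] in
/-- in the all-blue state with `b x = 1` the index is `0` -/
lemma idx_zero_of_b1 (q : BSlot (r := r) (b := b)) (he : q.1.1.1.2 = (true, true)) (hb : ¬ 2 ≤ b q.1.1.1.1) :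
    q.1.2.val = 0 := by
  have := idx_lt_tt q he; omega

omit [Preorder X] [DecidableEq X] [DecidableRel (α := X) (· ≤ ·)] in
/-- in the all-blue state a non-zero index is `1` and `b x ≥ 2` -/
lemma idx_one (q : BSlot (r := r) (b := b)) (he : q.1.1.1.2 = (true, true)) (hi : ¬ q.1.2.val = 0) :
    q.1.2.val = 1 ∧ 2 ≤ b q.1.1.1.1 := by
  have := idx_lt_tt q he; omega

omit [DecidableRel (α := X) (· ≤ ·)] in
/-- **the assignment is injective** -/
theorem bundleAssign_injective (A : Assign r b) : Function.Injective (bundleAssign A) := by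
  intro q q' hqq'
  unfold bundleAssign at hqq'
  by_cases he : q.1.1.1.2 = (true, true) <;> by_cases he' : q'.1.1.1.2 = (true, true)
  · -- both all-blue
    rw [dif_pos he, dif_pos he'] at hqq'
    have hb1 := tt_b q he; have hb1' := tt_b q' he'
    by_cases hr : 1 ≤ r q.1.1.1.1 <;> by_cases hr' : 1 ≤ r q'.1.1.1.1
    · rw [dif_pos hr, dif_pos hr'] at hqq'
      by_cases hi : q.1.2.val = 0 <;> by_cases hi' : q'.1.2.val = 0
      · rw [if_pos hi, if_pos hi'] at hqq'
        exact bslot_ext q q' (Prod.ext (Prod.mk.inj hqq').1 (by rw [he, he'])) (by rw [hi, hi'])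
      · rw [if_pos hi, if_neg hi'] at hqq'
        exact absurd (Prod.mk.inj hqq').2 (by decide)
      · rw [if_neg hi, if_pos hi'] at hqq'
        exact absurd (Prod.mk.inj hqq').2 (by decide)
      · rw [if_neg hi, if_neg hi'] at hqq'
        exact bslot_ext q q' (Prod.ext (Prod.mk.inj hqq').1 (by rw [he, he']))
          (by rw [(idx_one q he hi).1, (idx_one q' he' hi').1])
    · rw [dif_pos hr, dif_neg hr'] at hqq'
      by_cases hb' : 2 ≤ b q'.1.1.1.1
      · rw [dif_pos hb'] at hqq'
        by_cases hi : q.1.2.val = 0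
        · rw [if_pos hi] at hqq'; exact absurd (Prod.mk.inj hqq').2 (by decide)
        · rw [if_neg hi] at hqq'
          have hx := (Prod.mk.inj hqq').1
          have hbv : b (A.v (vslot q'.1.1.1.1 ⟨by omega, hb'⟩ q'.1.2.val
              (lt_of_lt_of_le (idx_lt_tt q' he') (min_le_left _ _)))) = 1 := (A.hvs _).2.1
          rw [← hx] at hbv
          have := (idx_one q he hi).2; omega
      · rw [dif_neg hb'] at hqq'
        by_cases hi : q.1.2.val = 0
        · rw [if_pos hi] at hqq'; exact absurd (Prod.mk.inj hqq').2 (by decide)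
        · rw [if_neg hi] at hqq'; exact absurd (Prod.mk.inj hqq').2 (by decide)
    · rw [dif_neg hr, dif_pos hr'] at hqq'
      by_cases hb : 2 ≤ b q.1.1.1.1
      · rw [dif_pos hb] at hqq'
        by_cases hi' : q'.1.2.val = 0
        · rw [if_pos hi'] at hqq'; exact absurd (Prod.mk.inj hqq').2 (by decide)
        · rw [if_neg hi'] at hqq'
          have hx := (Prod.mk.inj hqq').1
          have hbv : b (A.v (vslot q.1.1.1.1 ⟨by omega, hb⟩ q.1.2.val
              (lt_of_lt_of_le (idx_lt_tt q he) (min_le_left _ _)))) = 1 := (A.hvs _).2.1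
          rw [hx] at hbv
          have := (idx_one q' he' hi').2; omega
      · rw [dif_neg hb] at hqq'
        by_cases hi' : q'.1.2.val = 0
        · rw [if_pos hi'] at hqq'; exact absurd (Prod.mk.inj hqq').2 (by decide)
        · rw [if_neg hi'] at hqq'; exact absurd (Prod.mk.inj hqq').2 (by decide)
    · rw [dif_neg hr, dif_neg hr'] at hqq'
      by_cases hb : 2 ≤ b q.1.1.1.1 <;> by_cases hb' : 2 ≤ b q'.1.1.1.1
      · rw [dif_pos hb, dif_pos hb'] at hqq'
        have hx := A.hv (Prod.mk.inj hqq').1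
        have h1 : q.1.1.1.1 = q'.1.1.1.1 :=
          congrArg (fun s : SlotL (fun x => r x = 0 ∧ 2 ≤ b x) b => s.1.1.1) hx
        have h2 : q.1.2.val = q'.1.2.val :=
          congrArg (fun s : SlotL (fun x => r x = 0 ∧ 2 ≤ b x) b => s.1.2.val) hx
        exact bslot_ext q q' (Prod.ext h1 (by rw [he, he'])) h2
      · rw [dif_pos hb, dif_neg hb'] at hqq'; exact absurd (Prod.mk.inj hqq').2 (by decide)
      · rw [dif_neg hb, dif_pos hb'] at hqq'; exact absurd (Prod.mk.inj hqq').2 (by decide)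
      · rw [dif_neg hb, dif_neg hb'] at hqq'
        have hx := A.hg (Prod.mk.inj hqq').1
        have h1 : q.1.1.1.1 = q'.1.1.1.1 :=
          congrArg (fun s : SlotL (fun x => r x = 0 ∧ 1 ≤ b x) b => s.1.1.1) hx
        exact bslot_ext q q' (Prod.ext h1 (by rw [he, he']))
          (by rw [idx_zero_of_b1 q he hb, idx_zero_of_b1 q' he' hb'])
  · -- q all-blue, q' one-blue: the image of q' has `b = 0` on its `X`-coordinate
    rw [dif_pos he, dif_neg he'] at hqq'
    have hbh := (A.hhs (hslot q'.1.1.1.1 ⟨(one_blue q' (one_blue_of_ne q' he')).1, (one_blue q' (one_blue_of_ne q' he')).2.1⟩)).2.2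
    have hb1 := tt_b q he
    by_cases hr : 1 ≤ r q.1.1.1.1
    · rw [dif_pos hr] at hqq'
      by_cases hi : q.1.2.val = 0
      · rw [if_pos hi] at hqq'
        have hx := (Prod.mk.inj hqq').1; rw [← hx] at hbh; omega
      · rw [if_neg hi] at hqq'
        have hx := (Prod.mk.inj hqq').1; rw [← hx] at hbh; omega
    · rw [dif_neg hr] at hqq'
      by_cases hb : 2 ≤ b q.1.1.1.1
      · rw [dif_pos hb] at hqq'
        have hx := (Prod.mk.inj hqq').1
        have hbv : b (A.v (vslot q.1.1.1.1 ⟨by omega, hb⟩ q.1.2.val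
            (lt_of_lt_of_le (idx_lt_tt q he) (min_le_left _ _)))) = 1 := (A.hvs _).2.1
        rw [hx] at hbv; omega
      · rw [dif_neg hb] at hqq'
        have hs := (Prod.mk.inj hqq').2
        rcases one_blue_of_ne q' he' with h | h <;> rw [h] at hs <;> exact absurd hs (by decide)
  · -- q one-blue, q' all-blue: symmetric
    rw [dif_neg he, dif_pos he'] at hqq'
    have hbh := (A.hhs (hslot q.1.1.1.1 ⟨(one_blue q (one_blue_of_ne q he)).1, (one_blue q (one_blue_of_ne q he)).2.1⟩)).2.2
    have hb1' := tt_b q' he'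
    by_cases hr' : 1 ≤ r q'.1.1.1.1
    · rw [dif_pos hr'] at hqq'
      by_cases hi' : q'.1.2.val = 0
      · rw [if_pos hi'] at hqq'
        have hx := (Prod.mk.inj hqq').1; rw [hx] at hbh; omega
      · rw [if_neg hi'] at hqq'
        have hx := (Prod.mk.inj hqq').1; rw [hx] at hbh; omega
    · rw [dif_neg hr'] at hqq'
      by_cases hb' : 2 ≤ b q'.1.1.1.1
      · rw [dif_pos hb'] at hqq'
        have hx := (Prod.mk.inj hqq').1
        have hbv : b (A.v (vslot q'.1.1.1.1 ⟨by omega, hb'⟩ q'.1.2.val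
            (lt_of_lt_of_le (idx_lt_tt q' he') (min_le_left _ _)))) = 1 := (A.hvs _).2.1
        rw [← hx] at hbv; omega
      · rw [dif_neg hb'] at hqq'
        have hs := (Prod.mk.inj hqq').2
        rcases one_blue_of_ne q he with h | h <;> rw [h] at hs <;> exact absurd hs (by decide)
  · -- both one-blue
    rw [dif_neg he, dif_neg he'] at hqq'
    have hs := (Prod.mk.inj hqq').2
    have hx := A.hh (Prod.mk.inj hqq').1
    have h1 : q.1.1.1.1 = q'.1.1.1.1 :=
      congrArg (fun s : SlotL (fun x => r x = 0 ∧ 1 ≤ b x) (fun _ => 1) => s.1.1.1) hx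
    exact bslot_ext q q' (Prod.ext h1 hs)
      (by rw [(one_blue q (one_blue_of_ne q he)).2.2, (one_blue q' (one_blue_of_ne q' he')).2.2])

/-- **(UH*) holds for `X` in series with a bundle of two free edges, given `G_1`, the level-1 Harris inequality and
`V2_2` on `X`** — the doubling of a leaf in the critical context, from the graded family alone. -/
theorem universal_ser_bundle2 (hG : GDom 1 r b) (hV : VDom 2 r b) (hH : LevelHarris r b) :
    Universal (serR2 r) (serB2 b) := by
  obtain ⟨A⟩ := assign_exists r b hG hV hH
  exact ⟨bundleAssign A, bundleAssign_injective A, bundleAssign_spec A⟩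

end bundle

end Summit.Ventures.PercRepro2.UHClosure
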